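import Summits.QuantumFields.YangMills.Theorems.BalabanUVNodesN15TwoGridCovDPieceDefect
import Summits.QuantumFields.YangMills.Theorems.BalabanUVNodesN15TwoSpacingGluingShiftedRow
import HarnessLib

/-!
# N15 = NE2, road (c) — PROGRAMME (PC), (PC-E-J) GROUNDWORK: THE SHIFT-DEFECT ROW OF A DRESSED CUBE ACROSS KING's PAIRING AND THE OUTPUT PLATEAU OF THE JET PIECE — the
# generic producers of n15-c∕407's displayed rows `hDS`, `hJout`, `hSχe′` (dag-n15-c g35, n15-c∕409)

Cell `pub-ymgap`, seat `pub-ymgap-dag-n15-c` (generation g35; R134 (a) seat, strategy s1 «first missing estimate»; HUMAN RULING D-0062; chair R424 venue).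
`bears_on: R4∕N15 · K3⁸ SpineGivenEndpointR13SepCoPHV (stmt-QuantumFields-27366)`; filed `--kind proof --supports stmt-QuantumFields-27366 --as helper` — COUNT-NEUTRAL.
SIX lemmas, 0 `def`, 0 `sorry`; [folklore] block-norm bookkeeping.  Imports BY NAME n15-c∕400 `…TwoGridCovDPieceDefect` (`hasMaj_idef_shift_comp_of_rows`) and n15-c∕403
`…TwoSpacingGluingShiftedRow` (`hasMaj_pull_shift_loc₂`); B11 `loc_ofBlocks_le` ∕ `abs_le_loc_ofBlocks`.

WHAT.  (1) `hasMaj_idef_shiftPair_comp_of_cross`: under KING's PAIRING DICHOTOMY `π(x′ + e′) ∈ {πx′, πx′ + e}` the two-grid defect of the SHIFTS after an operator,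
`(τ_{e′}^*∘π^* − π^*∘τ_e^*)∘Y`, is read entrywise as `0` or `−n⁻¹·(∇_eY)(πx′)`: `≤ n⁻¹·K` from the jet row `∇_e∘Y ≤ K` (the «`O(η)·∇Y`» row).  (2) `mulOp_orCut_comp_idef`: the two-grid
defect `𝔇(X′, X) = X′∘π^* − π^*∘X` of output-cut pieces (`M_{χ′}X′ = X′`, `M_χX = X`) is cut by the joint plateau `a′ = 1_{χ′ ≠ 0 ∨ χ∘π ≠ 0}`; (3) `hasMaj_pull_shift_idef_loc₂`: hence
n15-c∕403's shifted-row device applies to `τ_{e′}^*∘𝔇(X′, X)` (cost `e^{ρd₁}`, localization kept by the shifted-support margins `hSχe∕hSχe′` and the dichotomy); (4)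
`hasMaj_idef_shift_comp_loc₂`: (1)+(3) through n15-c∕400's `𝔇(τ′^*X′, τ^*X) = τ′^*∘𝔇(X′,X) + 𝔇(τ′^*, τ^*)∘X` give n15-c∕407's displayed row `hDS` with `m_S = A_D·e^{ρd₁} + n⁻¹·B`;
(5) `mulOp_comp_covD_comp_cut_of_support`: the output plateau of the jet piece (`hJout`): `M_ψ∘D_R∘(M_χ∘Z) = D_R∘(M_χ∘Z)` when `ψ = 1` where `χ ≠ 0` or `χ(·+e) ≠ 0`;
(6) `shifted_support_fine_of_cross`: the fine shifted-support margin `hSχe′` from the coarse one, `hSχ` and the dichotomy when `χ′ = χ∘π`.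

HONEST FRAMING ∕ LIMITS.  Generic bookkeeping; nothing of [B9] asserted; NE2⁺ NOT PRINTED ∕ NOT proved; N15 of record untouched (DISCHARGED AS CONSUMED, p687738); K3⁸ OPEN; counts of
record UNMOVED (typed 28∕28 · discharged 8∕27); one finite 𝕋⁴ at fixed ε per index — NOT infinite volume, NOT OS on ℝ⁴, NOT a mass gap, NOT Clay.  Restate-immune (no Theses import).
-/

set_option autoImplicit false

noncomputable section
open scoped BigOperators Matrix
open Finset

namespace Summit.QuantumFields.YangMills.BalabanUVNodes.N15.Gluing

open Literature.MathematicalPhysics.QuantumFieldTheory.Balaban1983to89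
open Literature.MathematicalPhysics.QuantumFieldTheory.Balaban1983to89.B11SectG (BlockNorm HasMaj)
open Literature.MathematicalPhysics.QuantumFieldTheory.Balaban1983to89.B11AxialTransport190 (loc_ofBlocks_le abs_le_loc_ofBlocks)
open Literature.MathematicalPhysics.QuantumFieldTheory.Balaban1983to89.B6RandomWalk (Triangle254)
open Literature.MathematicalPhysics.QuantumFieldTheory.Balaban1983to89.T4EtaRateDefect (idef idef_apply)
open Literature.MathematicalPhysics.QuantumFieldTheory.Balaban1983to89.T4EtaRateCoeffDefect (pull pull_apply)
open Literature.MathematicalPhysics.QuantumFieldTheory.Balaban1983to89.B6Prop26Gluing (mulOp mulOp_apply ind ind_nonneg)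
open Summit.QuantumFields.YangMills.BalabanUVNodes.N15.MatrixSpecies (mmulOp liftBlk liftMap liftEquiv liftEquiv_apply covD covD_apply)
open Summit.QuantumFields.YangMills.BalabanUVNodes.N15.BackgroundLayer (fgrad fgrad_apply)

variable {X X' : Type} [Fintype X] [Fintype X'] {ι : Type} [Fintype ι] [DecidableEq ι] {g : B6.Geometry} (blk : X → g.Site) (π : X' → X)
  {F₁ : Type} [AddCommGroup F₁] [Module ℝ F₁] {b₁ : BlockNorm g F₁}

omit [DecidableEq ι] in
/-- ★★ **THE TWO-GRID DEFECT OF THE SHIFTS AFTER AN OPERATOR COSTS `η = n⁻¹` AGAINST THE JET ROW** under King's pairing dichotomy `π(x′ + e′) ∈ {πx′, πx′ + e}`: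
`((τ_{e′}^*π^* − π^*τ_e^*)Y f)(x′, i) ∈ {0, −n⁻¹(∇_e Y f)(πx′, i)}`, so `(τ_{e′}^*π^* − π^*τ_e^*)∘Y ≤ n⁻¹·K` from `∇_e∘Y ≤ K` (`K ≥ 0`, `n > 0`).
[cite: King1986, p.664 (pairing convention «x′ ∈ B^n(x)»); Balaban1985BackgroundPropagators, Thm 3.14 pp.426–427 (difference template: the `O(η)` terms)] -/
theorem hasMaj_idef_shiftPair_comp_of_cross (e : X ≃ X) (e' : X' ≃ X') {n : ℝ} (hn : 0 < n) (hcross : ∀ x', π (e' x') = π x' ∨ π (e' x') = e (π x'))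
    {Y : F₁ →ₗ[ℝ] (X × ι → ℝ)} {K : g.Site → g.Site → ℝ} (hK : ∀ y y', 0 ≤ K y y')
    (hJ : HasMaj b₁ (BlockNorm.ofBlocks g (liftBlk blk ι)) (fgrad n (liftEquiv e ι) ∘ₗ Y) K) :
    HasMaj b₁ (BlockNorm.ofBlocks g (liftBlk (blk ∘ π) ι))
      (idef (pull (liftMap π ι)) (pull (liftMap π ι)) (pull (liftEquiv e' ι)) (pull (liftEquiv e ι)) ∘ₗ Y) (fun y y' => n⁻¹ * K y y') := by
  intro y' μ hμ y
  refine loc_ofBlocks_le (liftBlk (blk ∘ π) ι) _ (mul_nonneg (mul_nonneg (inv_nonneg.mpr hn.le) (hK y y')) (b₁.loc_nonneg y' μ)) fun p hp => ?_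
  have hval : (idef (pull (liftMap π ι)) (pull (liftMap π ι)) (pull (liftEquiv e' ι)) (pull (liftEquiv e ι)) ∘ₗ Y) μ p = Y μ (π (e' p.1), p.2) - Y μ (e (π p.1), p.2) := by
    simp only [LinearMap.comp_apply, idef_apply, pull_apply, liftEquiv_apply, Pi.sub_apply]
  have hjet : |(fgrad n (liftEquiv e ι) ∘ₗ Y) μ (π p.1, p.2)| ≤ K y y' * b₁.loc y' μ :=
    (abs_le_loc_ofBlocks (liftBlk blk ι) _ (x' := (π p.1, p.2)) hp).trans (hJ y' μ hμ y)
  have hj : (fgrad n (liftEquiv e ι) ∘ₗ Y) μ (π p.1, p.2) = n * (Y μ (e (π p.1), p.2) - Y μ (π p.1, p.2)) := by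
    simp only [LinearMap.comp_apply, fgrad_apply, liftEquiv_apply]
  rw [hval]
  rcases hcross p.1 with h | h
  · rw [h]
    have : Y μ (π p.1, p.2) - Y μ (e (π p.1), p.2) = -(n⁻¹ * (fgrad n (liftEquiv e ι) ∘ₗ Y) μ (π p.1, p.2)) := by
      rw [hj, ← mul_assoc, inv_mul_cancel₀ hn.ne', one_mul, neg_sub]
    rw [this, abs_neg, abs_mul, abs_of_pos (inv_pos.mpr hn), mul_assoc]
    exact mul_le_mul_of_nonneg_left hjet (inv_nonneg.mpr hn.le)
  · rw [h, sub_self, abs_zero]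
    exact mul_nonneg (mul_nonneg (inv_nonneg.mpr hn.le) (hK y y')) (b₁.loc_nonneg y' μ)

omit [Fintype X] [Fintype X'] [Fintype ι] [DecidableEq ι] in
/-- ★ **THE JOINT PLATEAU OF A TWO-GRID DEFECT OF OUTPUT-CUT PIECES**: `M_{a′}∘(X′∘π^* − π^*∘X) = X′∘π^* − π^*∘X` for `a′ = 1_{χ′ ≠ 0 ∨ χ∘π ≠ 0}` when `M_{χ′}X′ = X′`, `M_χX = X`.
[folklore] -/
theorem mulOp_orCut_comp_idef [DecidableEq X'] {χ : X → ℝ} {χ' : X' → ℝ} {Xc : (X × ι → ℝ) →ₗ[ℝ] (X × ι → ℝ)} {Xf : (X' × ι → ℝ) →ₗ[ℝ] (X' × ι → ℝ)}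
    (hχX : mulOp (fun p : X × ι => χ p.1) ∘ₗ Xc = Xc) (hχX' : mulOp (fun p : X' × ι => χ' p.1) ∘ₗ Xf = Xf) :
    mulOp (fun p : X' × ι => (fun x' => if χ' x' = 0 ∧ χ (π x') = 0 then (0 : ℝ) else 1) p.1) ∘ₗ idef (pull (liftMap π ι)) (pull (liftMap π ι)) Xf Xc =
      idef (pull (liftMap π ι)) (pull (liftMap π ι)) Xf Xc := by
  refine LinearMap.ext fun f => funext fun p => ?_
  simp only [LinearMap.comp_apply, mulOp_apply, idef_apply, Pi.sub_apply, pull_apply]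
  by_cases h : χ' p.1 = 0 ∧ χ (π p.1) = 0
  · have h1 : Xf (pull (liftMap π ι) f) p = 0 := by
      have := congrArg (fun T => T (pull (liftMap π ι) f) p) hχX'
      simp only [LinearMap.comp_apply, mulOp_apply] at this
      rw [← this, h.1, zero_mul]
    have h2 : Xc f (liftMap π ι p) = 0 := by
      have := congrArg (fun T => T f (liftMap π ι p)) hχX
      simp only [LinearMap.comp_apply, mulOp_apply] at this
      rw [← this, h.2, zero_mul]
    rw [if_pos h, h1, h2, sub_zero, mul_zero]
  · rw [if_neg h, one_mul]

omit [DecidableEq ι] in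
/-- ★★ **THE SHIFTED TWO-GRID DEFECT OF OUTPUT-CUT PIECES** (n15-c∕403's device on `τ_{e′}^*∘𝔇(X′, X)`): with `M_χX = X`, `M_{χ′}X′ = X′`, the supports `χ ≠ 0 ⟹ B ∈ S`, the
shifted-support margins `χ(x+e) ≠ 0 ⟹ B(x) ∈ S`, `χ′(x′+e′) ≠ 0 ⟹ B(πx′) ∈ S`, King's dichotomy and `dist(B(π(x′+e′)), B(πx′)) ≤ d₁`:
`𝔇(X′,X) ≤ 1_S1_S·βe^{−ρd}` ⟹ `τ_{e′}^*∘𝔇(X′,X) ≤ 1_S1_S·βe^{ρd₁}e^{−ρd}`. [folklore] -/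
theorem hasMaj_pull_shift_idef_loc₂ [DecidableEq X'] (htri : Triangle254 g) (hsymm : ∀ y y', g.dist y y' = g.dist y' y) (e : X ≃ X) (e' : X' ≃ X')
    {χ : X → ℝ} {χ' : X' → ℝ} {S : Set g.Site} {Xc : (X × ι → ℝ) →ₗ[ℝ] (X × ι → ℝ)} {Xf : (X' × ι → ℝ) →ₗ[ℝ] (X' × ι → ℝ)} {β ρ d₁ : ℝ} (hβ : 0 ≤ β) (hρ : 0 ≤ ρ)
    (hχX : mulOp (fun p : X × ι => χ p.1) ∘ₗ Xc = Xc) (hχX' : mulOp (fun p : X' × ι => χ' p.1) ∘ₗ Xf = Xf)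
    (hSχ : ∀ x, χ x ≠ 0 → blk x ∈ S) (hSχe : ∀ x, χ (e x) ≠ 0 → blk x ∈ S) (hSχe' : ∀ x', χ' (e' x') ≠ 0 → blk (π x') ∈ S)
    (hcross : ∀ x', π (e' x') = π x' ∨ π (e' x') = e (π x')) (hstep' : ∀ x', g.dist (blk (π (e' x'))) (blk (π x')) ≤ d₁)
    (hD : HasMaj (BlockNorm.ofBlocks g (liftBlk blk ι)) (BlockNorm.ofBlocks g (liftBlk (blk ∘ π) ι)) (idef (pull (liftMap π ι)) (pull (liftMap π ι)) Xf Xc)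
      (fun y y' => ind S y * ind S y' * (β * Real.exp (-(ρ * g.dist y y'))))) :
    HasMaj (BlockNorm.ofBlocks g (liftBlk blk ι)) (BlockNorm.ofBlocks g (liftBlk (blk ∘ π) ι)) (pull (liftEquiv e' ι) ∘ₗ idef (pull (liftMap π ι)) (pull (liftMap π ι)) Xf Xc)
      (fun y y' => ind S y * ind S y' * (β * Real.exp (ρ * d₁) * Real.exp (-(ρ * g.dist y y')))) := by
  refine hasMaj_pull_shift_loc₂ (blk ∘ π) htri hsymm e' hβ hρ (χ := fun x' => if χ' x' = 0 ∧ χ (π x') = 0 then (0 : ℝ) else 1)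
    (mulOp_orCut_comp_idef π hχX hχX') (fun x' hx => ?_) hstep' hD
  have h' : ¬(χ' (e' x') = 0 ∧ χ (π (e' x')) = 0) := fun h => hx (by simp only [if_pos h])
  by_cases h1 : χ' (e' x') = 0
  · have h2 : χ (π (e' x')) ≠ 0 := fun h2 => h' ⟨h1, h2⟩
    rcases hcross x' with h | h
    · rw [h] at h2; exact hSχ _ h2
    · rw [h] at h2; exact hSχe _ h2
  · exact hSχe' x' h1

omit [DecidableEq ι] in
/-- ★★★ **THE SHIFT-DEFECT ROW OF A DRESSED CUBE ACROSS THE PAIRING** (n15-c∕407's `hDS`): `𝔇(τ_{e′}^*X′, τ_e^*X) = τ_{e′}^*∘𝔇(X′,X) + 𝔇(τ_{e′}^*, τ_e^*)∘X ≤ 1_S1_S·(A·e^{ρd₁} +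
n⁻¹·B)·e^{−ρd}` from the cube defect `𝔇(X′,X) ≤ 1_S1_S·Ae^{−ρd}`, the jet row `∇_e∘X ≤ 1_S1_S·Be^{−ρd}`, the output cuts, the supports ∕ margins, the dichotomy and the step.
[cite: Balaban1985BackgroundPropagators, Thm 3.14 pp.426–427 (difference template); King1986, p.664 (pairing)] -/
theorem hasMaj_idef_shift_comp_loc₂ [DecidableEq X'] (htri : Triangle254 g) (hsymm : ∀ y y', g.dist y y' = g.dist y' y) (e : X ≃ X) (e' : X' ≃ X') {n : ℝ} (hn : 0 < n)
    {χ : X → ℝ} {χ' : X' → ℝ} {S : Set g.Site} {Xc : (X × ι → ℝ) →ₗ[ℝ] (X × ι → ℝ)} {Xf : (X' × ι → ℝ) →ₗ[ℝ] (X' × ι → ℝ)} {A B ρ d₁ : ℝ} (hA : 0 ≤ A) (hB : 0 ≤ B) (hρ : 0 ≤ ρ)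
    (hχX : mulOp (fun p : X × ι => χ p.1) ∘ₗ Xc = Xc) (hχX' : mulOp (fun p : X' × ι => χ' p.1) ∘ₗ Xf = Xf)
    (hSχ : ∀ x, χ x ≠ 0 → blk x ∈ S) (hSχe : ∀ x, χ (e x) ≠ 0 → blk x ∈ S) (hSχe' : ∀ x', χ' (e' x') ≠ 0 → blk (π x') ∈ S)
    (hcross : ∀ x', π (e' x') = π x' ∨ π (e' x') = e (π x')) (hstep' : ∀ x', g.dist (blk (π (e' x'))) (blk (π x')) ≤ d₁)
    (hD : HasMaj (BlockNorm.ofBlocks g (liftBlk blk ι)) (BlockNorm.ofBlocks g (liftBlk (blk ∘ π) ι)) (idef (pull (liftMap π ι)) (pull (liftMap π ι)) Xf Xc)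
      (fun y y' => ind S y * ind S y' * (A * Real.exp (-(ρ * g.dist y y')))))
    (hJ : HasMaj (BlockNorm.ofBlocks g (liftBlk blk ι)) (BlockNorm.ofBlocks g (liftBlk blk ι)) (fgrad n (liftEquiv e ι) ∘ₗ Xc)
      (fun y y' => ind S y * ind S y' * (B * Real.exp (-(ρ * g.dist y y'))))) :
    HasMaj (BlockNorm.ofBlocks g (liftBlk blk ι)) (BlockNorm.ofBlocks g (liftBlk (blk ∘ π) ι))
      (idef (pull (liftMap π ι)) (pull (liftMap π ι)) (pull (liftEquiv e' ι) ∘ₗ Xf) (pull (liftEquiv e ι) ∘ₗ Xc))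
      (fun y y' => ind S y * ind S y' * ((A * Real.exp (ρ * d₁) + n⁻¹ * B) * Real.exp (-(ρ * g.dist y y')))) := by
  have h1 := hasMaj_pull_shift_idef_loc₂ blk π htri hsymm e e' hA hρ hχX hχX' hSχ hSχe hSχe' hcross hstep' hD
  have h2 := hasMaj_idef_shiftPair_comp_of_cross blk π e e' hn hcross (Y := Xc)
    (fun y y' => mul_nonneg (mul_nonneg (ind_nonneg _ _) (ind_nonneg _ _)) (mul_nonneg hB (Real.exp_nonneg _))) hJ
  exact (hasMaj_idef_shift_comp_of_rows blk π (BlockNorm.ofBlocks g (liftBlk blk ι)) (pull (liftMap π ι)) (pull (liftMap π ι)) e e' h1 h2).mono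
    fun y y' => le_of_eq (by ring)

omit [Fintype X] in
/-- ★ **THE OUTPUT PLATEAU OF THE JET PIECE** (n15-c∕407's `hJout`): `M_ψ∘D_R∘(M_χ∘Z) = D_R∘(M_χ∘Z)` whenever `ψ = 1` where `χ ≠ 0` and where `χ(· + e) ≠ 0` — the covariant
derivative of the cut piece at `x` reads the piece at `x` and `x + e` only. [folklore] -/
theorem mulOp_comp_covD_comp_cut_of_support {F : Type} [AddCommGroup F] [Module ℝ F] (η : ℝ) (R : X → Matrix ι ι ℝ) (s : X → X) {χ ψ : X → ℝ}
    (hψχ : ∀ x, χ x ≠ 0 → ψ x = 1) (hψχe : ∀ x, χ (s x) ≠ 0 → ψ x = 1) (Z : F →ₗ[ℝ] (X × ι → ℝ)) :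
    mulOp (fun p : X × ι => ψ p.1) ∘ₗ (covD η R s ∘ₗ (mulOp (fun p : X × ι => χ p.1) ∘ₗ Z)) = covD η R s ∘ₗ (mulOp (fun p : X × ι => χ p.1) ∘ₗ Z) := by
  refine LinearMap.ext fun f => funext fun p => ?_
  simp only [LinearMap.comp_apply, mulOp_apply, covD_apply]
  by_cases h1 : χ p.1 = 0
  · by_cases h2 : χ (s p.1) = 0
    · simp only [h1, h2, zero_mul, mul_zero, Finset.sum_const_zero, sub_zero]
    · rw [hψχe p.1 h2, one_mul]
  · rw [hψχ p.1 h1, one_mul]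

omit [Fintype X] [Fintype X'] in
/-- ★ **THE FINE SHIFTED-SUPPORT MARGIN FROM THE COARSE ONE** (n15-c∕407's `hSχe′` when `χ′ = χ∘π`): by King's dichotomy `π(x′+e′) ∈ {πx′, πx′+e}`, `χ′(x′+e′) ≠ 0 ⟹ B(πx′) ∈ S`
from `χ ≠ 0 ⟹ B ∈ S` and `χ(x+e) ≠ 0 ⟹ B(x) ∈ S`. [cite: King1986, p.664 (pairing)] -/
theorem shifted_support_fine_of_cross (e : X ≃ X) (e' : X' ≃ X') {χ : X → ℝ} {χ' : X' → ℝ} {S : Set g.Site} (hχ' : ∀ x', χ' x' = χ (π x'))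
    (hSχ : ∀ x, χ x ≠ 0 → blk x ∈ S) (hSχe : ∀ x, χ (e x) ≠ 0 → blk x ∈ S) (hcross : ∀ x', π (e' x') = π x' ∨ π (e' x') = e (π x')) :
    ∀ x', χ' (e' x') ≠ 0 → blk (π x') ∈ S := fun x' hx => by
  rw [hχ'] at hx
  rcases hcross x' with h | h
  · rw [h] at hx; exact hSχ _ hx
  · rw [h] at hx; exact hSχe _ hx

end Summit.QuantumFields.YangMills.BalabanUVNodes.N15.Gluing

end
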